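import Summits.AnomalousDissipation.AnomalousDissipation.Theorems.BaireTransferRobustLoudUpgradeLinePeriodicDefs3
import Summits.AnomalousDissipation.AnomalousDissipation.Theorems.BaireTransferRobustLoudUpgradeStubLsSaddlePeriodic

/-!
# Line `malkin-cone-group-orbits`, companion c3: the INVISIBLE SADDLE OF CYCLES class and the extended line glue

Definitions + glue (reviewed for the definition).  `saddlePeriodic` packages the hypotheses of the landed
`LsFamilyPeriodic.stub_lsSaddlePeriodic` (periodic twin of c2's invisible saddle): `saddlePeriodic ⊆ robustCrossingPeriodic ⊆
closure (interior LOUD)`; `tamePeriodic4 := tamePeriodic3 ∪ saddlePeriodic`; `line_glue_c3d` (registered): the residual over `tamePeriodic4`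
proves the crux BY NAME.  References: Kielhöfer 2012 §I.16; Chow–Hale 1982 Ch. 7; Golubitsky–Schaeffer 1985 Ch. II; Iooss 1972.
-/

-- `Summit.<Summit>.<Problem>` is the tree's mandated summit-side namespace (CONVENTIONS §2); for this
-- single-conjunct summit the two coincide, so the duplicate is deliberate.
set_option linter.dupNamespace false

noncomputable section

open scoped BigOperators Topology
open Filter Set Function TopologicalSpace MeasureTheory

namespace Summit.AnomalousDissipation.AnomalousDissipation.Theorems.RobustLoudUpgrade

open Literature.Analysis.FunctionSpaces Literature.Analysis.FunctionSpaces.Torus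
open Literature.Analysis.FluidPDE
open Summit.AnomalousDissipation.AnomalousDissipation.Theses.BaireTransfer

/-- **The invisible saddle of cycles in the force family** (concrete member of `robustCrossingPeriodic`; periodic twin of c2's invisible
saddle `lsIndefinite`).  `c` carries, at some `ν ∈ (0,a)`, a genuinely time-dependent `τ`-periodic classical witness `u` with STRICT budgets whose
free-period linearisation is SIMPLY degenerate (kernel `∂ₜu, v`); `H` is a real admissible `τ`-periodic BORDER field (the problem forced by
`β ∂ₜu + H` has no periodic solution); the direction `d ∈ P_S` is first-order INVISIBLE — the problem forced by `βd ∂ₜu + f_d` HAS a real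
admissible periodic solution `wd` (a response) — and the second-order form on the fibre `{d} × ℝ` is INDEFINITE, intrinsically: for every real
kernel pair `(wr, β')` (not a multiple of `∂ₜu`) and every real response pair `(we, βe)` there are `lp, lm`, `α > 0 > β` and real admissible
periodic solutions of the problems forced by `βp ∂ₜu + [(Z·∇)Z − (βe + l β') ∂ₜZ] + α H`, `Z = we + lp wr`, resp. `… + β H`, `Z = we + lm wr`.
(By time-translation equivariance the mixed second-order terms with the phase direction `∂ₜu` are solvable, so this sign pattern does not depend on
the kernel / response pairs used to probe it: it is the INDEFINITENESS of the intrinsic reduced quadratic form on the fibre `{d} × ℝ`.)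
No visibility, no isolation, no symmetry. (Kielhöfer 2012 §I.16; Chow–Hale 1982 Ch. 7; Golubitsky–Schaeffer 1985 Ch. II.) [folklore] -/
def saddlePeriodic (S : Finset (Fin 3 → ℤ)) (a E ε : ℝ) : Set (Coeff S) :=
  {c | ∃ ν : ℝ, 0 < ν ∧ ν < a ∧ ∃ (τ : ℝ) (u : ℝ → UnitAddTorus (Fin 3) → EuclideanSpace ℝ (Fin 3))
      (p : ℝ → UnitAddTorus (Fin 3) → ℝ), 0 < τ ∧
    IsClassicalNSSolutionOn Set.univ ν (fun _ => force S c) u p ∧ Function.Periodic u τ ∧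
      meanEnergy u < E ∧ ε < meanDissipation ν u ∧ (∃ t x, Torus.timeDerivWithin Set.univ u t x ≠ 0) ∧
      ∃ (v H wd : ℝ → UnitAddTorus (Fin 3) → EuclideanSpace ℝ (Fin 3)) (d : Coeff S) (βd : ℝ),
        IsSmoothSpaceTimeOn Set.univ v ∧ Function.Periodic v τ ∧ (∀ t, IsDivFree (v t)) ∧ (∀ t, HasZeroMean (v t)) ∧
        (¬ ∃ z : ℂ, ∀ t x, Torus.realToComplex (v t x) = z • velocityDot u t x) ∧
        (∀ (w : ℝ → UnitAddTorus (Fin 3) → EuclideanSpace ℂ (Fin 3)) (β : ℂ),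
          w ∈ linPeriodicSol ν u τ (fun t x => β • velocityDot u t x) →
            ∃ z₁ z₂ : ℂ, ∀ t x, w t x = z₁ • velocityDot u t x + z₂ • Torus.realToComplex (v t x)) ∧
        IsSmoothSpaceTimeOn Set.univ H ∧ Function.Periodic H τ ∧ (∀ t, IsDivFree (H t)) ∧ (∀ t, HasZeroMean (H t)) ∧
        (∀ β : ℂ, linPeriodicSol ν u τ (fun t x => β • velocityDot u t x + Torus.realToComplex (H t x)) = ∅) ∧
        IsSmoothSpaceTimeOn Set.univ wd ∧ Function.Periodic wd τ ∧ (∀ t, IsDivFree (wd t)) ∧ (∀ t, HasZeroMean (wd t)) ∧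
        (fun t x => Torus.realToComplex (wd t x)) ∈ linPeriodicSol ν u τ (fun t x => (βd : ℂ) • velocityDot u t x + cplx (force S d) x) ∧
        (∀ (wr we : ℝ → UnitAddTorus (Fin 3) → EuclideanSpace ℝ (Fin 3)) (β' βe : ℝ), IsSmoothSpaceTimeOn Set.univ wr → Function.Periodic wr τ →
          (fun t x => Torus.realToComplex (wr t x)) ∈ linPeriodicSol ν u τ (fun t x => (β' : ℂ) • velocityDot u t x) →
          (¬ ∃ z : ℂ, ∀ t x, Torus.realToComplex (wr t x) = z • velocityDot u t x) → IsSmoothSpaceTimeOn Set.univ we → Function.Periodic we τ →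
          (fun t x => Torus.realToComplex (we t x)) ∈ linPeriodicSol ν u τ (fun t x => (βe : ℂ) • velocityDot u t x + cplx (force S d) x) →
          ∃ (lp lm α β βp βm : ℝ) (wp wm : ℝ → UnitAddTorus (Fin 3) → EuclideanSpace ℝ (Fin 3)), 0 < α ∧ β < 0 ∧
            IsSmoothSpaceTimeOn Set.univ wp ∧ Function.Periodic wp τ ∧ (∀ t, IsDivFree (wp t)) ∧ (∀ t, HasZeroMean (wp t)) ∧
            (fun t x => Torus.realToComplex (wp t x)) ∈ linPeriodicSol ν u τ (fun t x => (βp : ℂ) • velocityDot u t x +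
              Torus.realToComplex (Torus.convect (fun y => we t y + lp • wr t y) (fun y => we t y + lp • wr t y) x -
                (βe + lp * β') • Torus.timeDerivWithin Set.univ (fun s y => we s y + lp • wr s y) t x + α • H t x)) ∧
            IsSmoothSpaceTimeOn Set.univ wm ∧ Function.Periodic wm τ ∧ (∀ t, IsDivFree (wm t)) ∧ (∀ t, HasZeroMean (wm t)) ∧
            (fun t x => Torus.realToComplex (wm t x)) ∈ linPeriodicSol ν u τ (fun t x => (βm : ℂ) • velocityDot u t x +
              Torus.realToComplex (Torus.convect (fun y => we t y + lm • wr t y) (fun y => we t y + lm • wr t y) x -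
                (βe + lm * β') • Torus.timeDerivWithin Set.univ (fun s y => we s y + lm • wr s y) t x + β • H t x)))}

/-- The tame union of the companion c3 after the invisible saddle: `tamePeriodic3` plus `saddlePeriodic`. [folklore] -/
def tamePeriodic4 (S : Finset (Fin 3 → ℤ)) (a E ε : ℝ) : Set (Coeff S) :=
  tamePeriodic3 S a E ε ∪ saddlePeriodic S a E ε

namespace LsCrossingPeriodic

/-- **`saddlePeriodic ⊆ robustCrossingPeriodic`** (registered sub-goal `saddlePeriodic_subset_robust`, from `stub_lsSaddlePeriodic`). [folklore] -/
theorem saddlePeriodic_subset_robust : ∀ (S : Finset (Fin 3 → ℤ)) (a E ε : ℝ), saddlePeriodic S a E ε ⊆ robustCrossingPeriodic S a E ε := by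
  intro S a E ε c hc
  obtain ⟨ν, hν, hνa, τ, u, p, hτ, hsol, hper, hE, hε, hmov, v, H, wd, d, βd, hsv, hperv, hvdiv, hv0, hdeg, hker, hH, hHper, hHdiv, hH0,
    hborder, hswd, hwdper, hwddiv, hwd0, hresp, hsaddle⟩ := hc
  obtain ⟨σ, hfam, hsign⟩ := LsFamilyPeriodic.stub_lsSaddlePeriodic S c d ν τ u p v H wd βd hν hτ hsol hper hmov hsv hperv hvdiv hv0 hdeg
    hker hH hHper hHdiv hH0 hborder hswd hwdper hwddiv hwd0 hresp hsaddle
  exact ⟨ν, hν, hνa, τ, u, p, hτ, hsol, hper, hE, hε, σ, hfam, hsign⟩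

/-- **`saddlePeriodic ⊆ closure (interior LOUD)`**: invisible saddles of cycles are limits of robustly loud forces. [folklore] -/
theorem saddlePeriodic_subset_closure_interior_loud (S : Finset (Fin 3 → ℤ)) (a E ε : ℝ) :
    saddlePeriodic S a E ε ⊆ closure (interior (loud S a E ε)) :=
  (saddlePeriodic_subset_robust S a E ε).trans (robustCrossingPeriodic_subset_closure_interior_loud S a E ε)

/-- **The tame union after the invisible saddle is force-open up to closure.** [folklore] -/
theorem tamePeriodic4_subset_closure_interior_loud (S : Finset (Fin 3 → ℤ)) (a E ε : ℝ) :
    tamePeriodic4 S a E ε ⊆ closure (interior (loud S a E ε)) :=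
  Set.union_subset (tamePeriodic3_subset_closure_interior_loud S a E ε) (saddlePeriodic_subset_closure_interior_loud S a E ε)

/-- **Extended line glue of the companion c3 (registered sub-goal `line_glue_c3d`)**: the residual over `tamePeriodic4` proves the crux
`RobustLoudUpgrade` BY NAME. [folklore] -/
theorem line_glue_c3d : (∀ S : Finset (Fin 3 → ℤ), unitStock ⊆ S → ∀ (a E ε : ℝ), 0 < a → 0 < ε → loud S a E ε ⊆ closure (tamePeriodic4 S a (2 * E) (ε / 2))) → RobustLoudUpgrade :=
  fun hRes => LsCrossing.RobustLoudUpgrade_of_residual (fun S a E ε => tamePeriodic4 S a E ε)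
    tamePeriodic4_subset_closure_interior_loud hRes

end LsCrossingPeriodic

end Summit.AnomalousDissipation.AnomalousDissipation.Theorems.RobustLoudUpgrade

end
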